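import Summits.QuantumFields.YangMills.Theorems.BalabanUVNodesN15KingModelGraphTreeLength

/-!
# BalabanUVNodes ∕ N15 — THE KING-MODEL RUNG (PART Α-m): THE TREE LENGTH IS ATTAINED AT A MINIMAL CONNECTING EDGE SET — for a nonnegative length, some edge
# set attaining `treeLength ρ U` connects `U` with NO redundant edge (removing any one of its edges disconnects `U`): the «shortest tree graph connecting {u_i}»
# of King p. 660 read as an inclusion-minimal connecting set (a Steiner tree of `U`)
# (Track A, DAG node N15 = NE2; FAN-OUT v1.1 §N15 s3 «KING-MODEL RUNG … NE2's analogue DECIDED in the model»)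

HONEST FRAMING.  Count-neutral (cell `pub-ymgap`, seat `pub-ymgap-dag-n15-e` g29; `--supports stmt-QuantumFields-27366 --as helper` = K3⁸
`SpineGivenEndpointR13SepCoPHV`).  TEMPLATE LITERATURE: C. King, *The U(1) Higgs model. I. The continuum limit*, Commun. Math. Phys. **102** (1986) 649–677
[King1986], p. 660: *«We define dist({u_i}) to be the length of the shortest tree graph connecting {u_i}.»*  Part Α-b typed `treeLength ρ U` as the minimum of
the total length over ALL finite edge sets connecting `U` and noted that the minimum sits at a tree «by pruning, not typed».  THIS FILE types the pruning: the
minimum is attained at an edge set none of whose edges can be removed without disconnecting `U`.  Finite combinatorics only.  NOT Bałaban's `G(U)`; NOT a node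
discharge; nothing continuum ∕ ℝ⁴ ∕ OS ∕ mass-gap ∕ Clay.  0 `sorry`; standard axioms.

WHAT THIS FILE PROVES (namespace `Summit.QuantumFields.YangMills.BalabanUVNodes.N15KingModelRung.Graph`).
* `MinimalConnects U E` — `E` connects `U` and no `E.erase e` (`e ∈ E`) does.
* ★ `edgeLength_erase_le` (`ρ ≥ 0`: erasing an edge does not lengthen), ★★ **`exists_minimalConnects_edgeLength_eq_treeLength`** (`ρ ≥ 0`): some MINIMAL connecting
  edge set has total length exactly `treeLength ρ U` — among the minimisers take one of least cardinality; a removable edge would give a minimiser with fewer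
  edges.  ★ `treeLength_eq_min_minimalConnects`: `treeLength ρ U` is the least total length of a minimal connecting edge set.
* §2 (v1.1) ★ `eConn_erase_of_detour` (rerouting through a detour), ★★ **`MinimalConnects.isBridge`** (every edge of a minimal connecting set is a BRIDGE: erasing
  it separates its endpoints), ★ `MinimalConnects.loop_not_mem` ∕ `.swap_not_mem` (no loops, no antiparallel pairs), ★★ `exists_bridges_edgeLength_eq_treeLength`
  (`ρ ≥ 0`: the tree length is attained at a connecting edge set all of whose edges are bridges — King's shortest connecting graph IS a tree).
* §3 (v1.2) `edgeLength_singleton`, ★ `connects_union_glue`, ★★ **`treeLength_union_le_glue`** (`ρ ≥ 0`: `treeLength (U ∪ V) ≤ treeLength U + treeLength V + ρ(u, v)`,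
  `u ∈ U`, `v ∈ V` — gluing), ★ `treeLength_insert_le` (adding one point costs its distance to the set).
* §4 (v1.3) ★ `connects_star`, `edgeLength_star`, ★★ **`treeLength_le_sum_dist`** (the STAR bound `treeLength U ≤ Σ_{u ∈ U} ρ(u, u₀)` for ANY centre `u₀`, a
  Steiner point allowed), ★ `prod_exp_neg_dist_le_exp_treeLength` (pair decay to a common point IS tree decay: `Π_u e^{−δρ(u,u₀)} ≤ e^{−δ·treeLength U}`).

HONEST SCOPE.  An inclusion-minimal connecting edge set of `U` is a (Steiner) tree on its vertices — every edge is a bridge (§2); the counting restatement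
(`#edges + 1 = #vertices` per component) is not typed here.  RELATED OBJECT IN THE TREE (not re-declared, different object): the cell's
`Literature.….Balaban1983to89.TreeLength.treeLen` is Bałaban's linear size `d_j(X)` of a LOCALIZATION DOMAIN (continuum polygonal graphs through a union of unit
cubes, [Balaban1987RG1] p. 257); King's `dist({u_i})` here is the tree length of a finite POINT set for an arbitrary length `ρ` on a finite site sort.
Locators: [King1986] p.660.
-/

noncomputable section
namespace Summit.QuantumFields.YangMills.BalabanUVNodes.N15KingModelRung.Graph

open scoped BigOperators
open Finset

section Minimal
variable {T : Type*} [DecidableEq T]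

/-- **A MINIMAL CONNECTING EDGE SET**: `E` connects `U` and no edge of `E` is redundant. [cite: King1986, p.660 («the shortest tree graph connecting {u_i}»)] -/
def MinimalConnects (U : Finset T) (E : Finset (T × T)) : Prop := Connects U E ∧ ∀ e ∈ E, ¬ Connects U (E.erase e)

/-- ★ erasing an edge does not lengthen an edge set (`ρ ≥ 0`). [folklore] -/
theorem edgeLength_erase_le {ρ : T → T → ℝ} (hρ : ∀ a b, 0 ≤ ρ a b) (E : Finset (T × T)) (e : T × T) :
    edgeLength ρ (E.erase e) ≤ edgeLength ρ E :=
  sum_le_sum_of_subset_of_nonneg (erase_subset e E) fun _ _ _ => hρ _ _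

variable [Fintype T]

/-- ★★ **THE TREE LENGTH IS ATTAINED AT A MINIMAL CONNECTING EDGE SET** (`ρ ≥ 0`): there is `E` connecting `U`, with no redundant edge, and
`edgeLength ρ E = treeLength ρ U` — King's «shortest tree graph connecting {u_i}».  Among the edge sets attaining the minimum take one of least cardinality:
were one of its edges removable, the smaller set would still connect `U`, still attain the minimum (it is not longer, and nothing connecting is shorter), and
have fewer edges. [cite: King1986, p.660 («We define dist({u_i}) to be the length of the shortest tree graph connecting {u_i}»)] -/
theorem exists_minimalConnects_edgeLength_eq_treeLength {ρ : T → T → ℝ} (hρ : ∀ a b, 0 ≤ ρ a b) (U : Finset T) :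
    ∃ E : Finset (T × T), MinimalConnects U E ∧ edgeLength ρ E = treeLength ρ U := by
  classical
  -- the minimisers form a nonempty finite family; take one of least cardinality
  set S : Finset (Finset (T × T)) := (univ : Finset (Finset (T × T))).filter
    (fun E => Connects U E ∧ edgeLength ρ E = treeLength ρ U) with hS
  obtain ⟨E₀, hE₀c, hE₀l⟩ := exists_connects_edgeLength_eq ρ U
  have hSne : S.Nonempty := ⟨E₀, mem_filter.2 ⟨mem_univ _, hE₀c, hE₀l⟩⟩
  obtain ⟨E, hES, hmin⟩ := exists_min_image S Finset.card hSne
  obtain ⟨-, hEc, hEl⟩ := mem_filter.1 hES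
  refine ⟨E, ⟨hEc, fun e he hc => ?_⟩, hEl⟩
  -- a removable edge contradicts the least cardinality
  have hle : edgeLength ρ (E.erase e) ≤ treeLength ρ U := (edgeLength_erase_le hρ E e).trans (le_of_eq hEl)
  have hge : treeLength ρ U ≤ edgeLength ρ (E.erase e) := treeLength_le_edgeLength ρ hc
  have hmem : E.erase e ∈ S := mem_filter.2 ⟨mem_univ _, hc, le_antisymm hle hge⟩
  have h := hmin _ hmem
  rw [card_erase_of_mem he] at h
  have hpos : 0 < E.card := card_pos.2 ⟨e, he⟩
  omega

/-- ★ **`treeLength` IS THE LEAST LENGTH OF A MINIMAL CONNECTING EDGE SET** (`ρ ≥ 0`): for every minimal connecting `E′`, `treeLength ρ U ≤ edgeLength ρ E′`, and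
equality holds for some minimal connecting `E`. [cite: King1986, p.660] -/
theorem treeLength_eq_min_minimalConnects {ρ : T → T → ℝ} (hρ : ∀ a b, 0 ≤ ρ a b) (U : Finset T) :
    (∀ E' : Finset (T × T), MinimalConnects U E' → treeLength ρ U ≤ edgeLength ρ E') ∧
    ∃ E : Finset (T × T), MinimalConnects U E ∧ edgeLength ρ E = treeLength ρ U :=
  ⟨fun _ h => treeLength_le_edgeLength ρ h.1, exists_minimalConnects_edgeLength_eq_treeLength hρ U⟩

end Minimal

/-! ## §2 (v1.1) Every edge of a minimal connecting edge set is a bridge — King's shortest connecting graph is a tree -/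

section Bridges
variable {T : Type*} [DecidableEq T]

/-- ★ **REROUTING THROUGH A DETOUR**: if the endpoints of `e` are still joined in `E ∖ {e}`, then every chain of `E` can be rerouted inside `E ∖ {e}` (replace each
use of `e` by the detour). [folklore] -/
theorem eConn_erase_of_detour {E : Finset (T × T)} {e : T × T} (hdet : EConn (E.erase e) e.1 e.2) {u v : T} (h : EConn E u v) :
    EConn (E.erase e) u v := by
  induction h with
  | refl => exact Relation.ReflTransGen.refl
  | @tail w' w _ hedge ih =>
      by_cases hE' : EAdj (E.erase e) w' w
      · exact ih.tail hE'
      · -- the edge `{w', w}` of `E` is missing from `E ∖ {e}`, so it is `e` itself: splice in the detour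
        rcases hedge with he | he
        · have hwe : (w', w) = e := by
            by_contra hne
            exact hE' (Or.inl (mem_erase.2 ⟨hne, he⟩))
          have h1 : e.1 = w' := by rw [← hwe]
          have h2 : e.2 = w := by rw [← hwe]
          rw [h1, h2] at hdet
          exact eConn_trans ih hdet
        · have hwe : (w, w') = e := by
            by_contra hne
            exact hE' (Or.inr (mem_erase.2 ⟨hne, he⟩))
          have h1 : e.1 = w := by rw [← hwe]
          have h2 : e.2 = w' := by rw [← hwe]
          rw [h1, h2] at hdet
          exact eConn_trans ih (eConn_symm hdet)

/-- ★★ **EVERY EDGE OF A MINIMAL CONNECTING EDGE SET IS A BRIDGE**: removing it separates its own endpoints — otherwise the detour reroutes every chain and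
`E ∖ {e}` would still connect `U`.  (A finite graph all of whose edges are bridges is a forest: King's «shortest tree graph connecting {u_i}» IS a tree.)
[cite: King1986, p.660 («the shortest tree graph connecting {u_i}»)] -/
theorem MinimalConnects.isBridge {U : Finset T} {E : Finset (T × T)} (hM : MinimalConnects U E) {e : T × T} (he : e ∈ E) :
    ¬ EConn (E.erase e) e.1 e.2 := fun hdet =>
  hM.2 e he fun u hu v hv => eConn_erase_of_detour hdet (hM.1 u hu v hv)

/-- ★ a minimal connecting edge set has NO LOOP `(a, a)`. [folklore] -/
theorem MinimalConnects.loop_not_mem {U : Finset T} {E : Finset (T × T)} (hM : MinimalConnects U E) (a : T) : (a, a) ∉ E :=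
  fun h => hM.isBridge h Relation.ReflTransGen.refl

/-- ★ a minimal connecting edge set has NO ANTIPARALLEL PAIR: `(a, b) ∈ E ⇒ (b, a) ∉ E` (for `a = b` this is the loop case; for `a ≠ b` the reversed edge is a
detour). [folklore] -/
theorem MinimalConnects.swap_not_mem {U : Finset T} {E : Finset (T × T)} (hM : MinimalConnects U E) {a b : T} (hab : (a, b) ∈ E) : (b, a) ∉ E := by
  intro hba
  by_cases h : a = b
  · subst h
    exact hM.loop_not_mem a hab
  · refine hM.isBridge hab (Relation.ReflTransGen.single (Or.inr (mem_erase.2 ⟨?_, hba⟩)))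
    intro heq
    simp only [Prod.mk.injEq] at heq
    exact h heq.2

variable [Fintype T]

/-- ★★ **KING's SHORTEST CONNECTING GRAPH IS A TREE** (`ρ ≥ 0`): the tree length is attained at an edge set connecting `U` every edge of which is a bridge, with no
loop and no antiparallel pair. [cite: King1986, p.660 («We define dist({u_i}) to be the length of the shortest tree graph connecting {u_i}»)] -/
theorem exists_bridges_edgeLength_eq_treeLength {ρ : T → T → ℝ} (hρ : ∀ a b, 0 ≤ ρ a b) (U : Finset T) :
    ∃ E : Finset (T × T), Connects U E ∧ (∀ e ∈ E, ¬ EConn (E.erase e) e.1 e.2) ∧ (∀ a, (a, a) ∉ E) ∧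
      (∀ a b, (a, b) ∈ E → (b, a) ∉ E) ∧ edgeLength ρ E = treeLength ρ U := by
  obtain ⟨E, hM, hlen⟩ := exists_minimalConnects_edgeLength_eq_treeLength hρ U
  exact ⟨E, hM.1, fun e he => hM.isBridge he, hM.loop_not_mem, fun a b h => hM.swap_not_mem h, hlen⟩

end Bridges

/-! ## §3 (v1.2) Gluing: the tree length of a union — `d(U ∪ V) ≤ d(U) + d(V) + ρ(u, v)` -/

section Gluing
variable {T : Type*} [DecidableEq T]

omit [DecidableEq T] in
/-- the length of a single edge. [folklore] -/
theorem edgeLength_singleton (ρ : T → T → ℝ) (u v : T) : edgeLength ρ {(u, v)} = ρ u v := by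
  unfold edgeLength
  rw [sum_singleton]

/-- ★ **GLUING TWO CONNECTING EDGE SETS WITH ONE EDGE**: if `E_U` connects `U`, `E_V` connects `V`, `u ∈ U`, `v ∈ V`, then `E_U ∪ E_V ∪ {(u, v)}` connects `U ∪ V`.
[folklore] -/
theorem connects_union_glue {U V : Finset T} {EU EV : Finset (T × T)} (hU : Connects U EU) (hV : Connects V EV) {u v : T} (hu : u ∈ U)
    (hv : v ∈ V) : Connects (U ∪ V) (EU ∪ EV ∪ {(u, v)}) := by
  have hEU : EU ⊆ EU ∪ EV ∪ {(u, v)} := subset_union_left.trans subset_union_left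
  have hEV : EV ⊆ EU ∪ EV ∪ {(u, v)} := subset_union_right.trans subset_union_left
  have huv : EConn (EU ∪ EV ∪ {(u, v)}) u v := eConn_of_mem (mem_union_right _ (mem_singleton_self _))
  -- every point of `U ∪ V` is joined to `u`
  have key : ∀ z ∈ U ∪ V, EConn (EU ∪ EV ∪ {(u, v)}) z u := by
    intro z hz
    rcases mem_union.1 hz with hz | hz
    · exact eConn_mono hEU (hU z hz u hu)
    · exact eConn_trans (eConn_mono hEV (hV z hz v hv)) (eConn_symm huv)
  exact fun x hx y hy => eConn_trans (key x hx) (eConn_symm (key y hy))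

variable [Fintype T]

/-- ★★ **THE TREE LENGTH OF A UNION** (`ρ ≥ 0`): `treeLength ρ (U ∪ V) ≤ treeLength ρ U + treeLength ρ V + ρ(u, v)` for any `u ∈ U`, `v ∈ V` — glue two shortest
connecting edge sets with the edge `(u, v)`; the upper-bound companion of part Α-h's `treeLength_union_ge_avg`. [cite: King1986, p.660 («dist({u_i})»), p.662] -/
theorem treeLength_union_le_glue {ρ : T → T → ℝ} (hρ : ∀ a b, 0 ≤ ρ a b) {U V : Finset T} {u v : T} (hu : u ∈ U) (hv : v ∈ V) :
    treeLength ρ (U ∪ V) ≤ treeLength ρ U + treeLength ρ V + ρ u v := by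
  obtain ⟨EU, hEU, hlU⟩ := exists_connects_edgeLength_eq ρ U
  obtain ⟨EV, hEV, hlV⟩ := exists_connects_edgeLength_eq ρ V
  refine (treeLength_le_edgeLength ρ (connects_union_glue hEU hEV hu hv)).trans ?_
  calc edgeLength ρ (EU ∪ EV ∪ {(u, v)}) ≤ edgeLength ρ (EU ∪ EV) + edgeLength ρ {(u, v)} := edgeLength_union_le hρ _ _
    _ ≤ edgeLength ρ EU + edgeLength ρ EV + edgeLength ρ {(u, v)} := by
        have h := edgeLength_union_le hρ EU EV
        linarith
    _ = treeLength ρ U + treeLength ρ V + ρ u v := by rw [hlU, hlV, edgeLength_singleton]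

/-- ★ **ADDING ONE POINT COSTS ITS DISTANCE TO THE SET** (`ρ ≥ 0`): `treeLength ρ (insert w U) ≤ treeLength ρ U + ρ(u, w)` for any `u ∈ U`.
[cite: King1986, p.660, p.662 («sum over {w_l}»)] -/
theorem treeLength_insert_le {ρ : T → T → ℝ} (hρ : ∀ a b, 0 ≤ ρ a b) {U : Finset T} {u : T} (hu : u ∈ U) (w : T) :
    treeLength ρ (insert w U) ≤ treeLength ρ U + ρ u w := by
  have h := treeLength_union_le_glue hρ hu (mem_singleton_self w)
  have h0 : treeLength ρ ({w} : Finset T) = 0 := treeLength_of_card_le_one hρ (by rw [card_singleton])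
  rw [h0, add_zero] at h
  rwa [union_comm, ← insert_eq] at h

end Gluing

/-! ## §4 (v1.3) The star bound — pair decay to a root is tree decay -/

section Star
variable {T : Type*} [DecidableEq T]

/-- ★ **THE STAR AT `u₀` CONNECTS `U`** (any centre `u₀`, in `U` or not — a Steiner point): the edges `(u, u₀)`, `u ∈ U`. [folklore] -/
theorem connects_star (U : Finset T) (u₀ : T) : Connects U (U.image fun u => (u, u₀)) := by
  have key : ∀ u ∈ U, EConn (U.image fun u => (u, u₀)) u u₀ := fun u hu => eConn_of_mem (mem_image.2 ⟨u, hu, rfl⟩)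
  exact fun x hx y hy => eConn_trans (key x hx) (eConn_symm (key y hy))

omit [DecidableEq T] in
/-- the star's total length is `Σ_{u ∈ U} ρ(u, u₀)`. [folklore] -/
theorem edgeLength_star [DecidableEq T] (ρ : T → T → ℝ) (U : Finset T) (u₀ : T) :
    edgeLength ρ (U.image fun u => (u, u₀)) = ∑ u ∈ U, ρ u u₀ := by
  unfold edgeLength
  rw [sum_image fun a _ b _ h => (Prod.mk.inj h).1]

variable [Fintype T]

/-- ★★ **THE STAR BOUND** (any centre `u₀`, any `ρ`): `treeLength ρ U ≤ Σ_{u ∈ U} ρ(u, u₀)` — so legs decaying PAIRWISE to a common point already decay in the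
tree length: `Π_u e^{−δρ(u,u₀)} = e^{−δΣ_u ρ(u,u₀)} ≤ e^{−δ·treeLength U}` (`δ ≥ 0`). [cite: King1986, p.660 («dist({u_i})»), (3.56) p.662] -/
theorem treeLength_le_sum_dist (ρ : T → T → ℝ) (U : Finset T) (u₀ : T) : treeLength ρ U ≤ ∑ u ∈ U, ρ u u₀ := by
  rw [← edgeLength_star ρ U u₀]
  exact treeLength_le_edgeLength ρ (connects_star U u₀)

/-- ★ **PAIR DECAY TO A COMMON POINT IS TREE DECAY** (any `u₀`, `δ ≥ 0`): `Π_{u ∈ U} exp[−δρ(u, u₀)] ≤ exp[−δ·treeLength ρ U]`. [cite: King1986, (3.56) p.662] -/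
theorem prod_exp_neg_dist_le_exp_treeLength (ρ : T → T → ℝ) (U : Finset T) (u₀ : T) {δ : ℝ} (hδ : 0 ≤ δ) :
    ∏ u ∈ U, Real.exp (-(δ * ρ u u₀)) ≤ Real.exp (-(δ * treeLength ρ U)) := by
  rw [← Real.exp_sum, sum_neg_distrib, ← mul_sum]
  exact Real.exp_le_exp.2 (neg_le_neg (mul_le_mul_of_nonneg_left (treeLength_le_sum_dist ρ U u₀) hδ))

end Star

end Summit.QuantumFields.YangMills.BalabanUVNodes.N15KingModelRung.Graph

end
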